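import Mathlib
import HarnessLib
import Summits.HodgeConjecture.HodgeConjecture.Theorems.HodgeLocusCensusMu0631
import Summits.HodgeConjecture.HodgeConjecture.Theorems.HodgeLocusCensusExSet83Char0
import Summits.HodgeConjecture.HodgeConjecture.Theorems.HodgeLocusCensusExSet63Smooth
import Summits.HodgeConjecture.HodgeConjecture.Theorems.HodgeLocusCensusExSet63Certs
import Summits.HodgeConjecture.HodgeConjecture.Theorems.HodgeLocusCensusExSet63Canon

/-!
# Hodge-locus census — cells (6,3,1) and (6,3,0): exceptional sets and the exact generic slice fibre decided in characteristic 0, two implementations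

Certified instances and evidence bearing on the general Hodge conjecture; no claim.

Record: `run/shared/lean/pub/pub-hlocus/pub-hlocus-ivhs-2/gen24/record/M631-CHAR0-g24.md` (ivhs-2 = engine-B seat, generation 24; kit job j146803 = both
programs, phases exact + orient + smooth, both cells, canonical lines identical to the local logs).  Sequel of `HodgeLocusCensusExSet632Char0` (cell (6,3,2))
and `HodgeLocusCensusExSet83Char0` (cells (8,3,m)) with the same method and the same division of labour between the Lean kernel and two independent
programs, plus ONE NEW LAYER for the cell in which Maclean's quadratic obstruction is not of full rank on the kernel.

SETTING (as in the (6,3,2) and (8,3,m) files).  Cell (6,3,m): smooth cubic sixfolds X ⊂ ℙ⁷ containing two 3-planes P, P′ with dim P ∩ P′ = m;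
N = the locus of such cubics near X (smooth; codimension c = rank(α;β) = 8 in both cells here), V_λ = the Hodge locus of [P] + λ[P′] (q = dim R₇ = 8
equations, R = S/J(F) the Jacobian ring, socle R₈), μ₀(6,3,m;λ) = the multiplicity of V_λ along N.  At a FIXED smooth X: B(λ) = (α + λβ)|_U
(U = a coordinate complement of T_X N, #U = c = 8) is an 8 × 8 matrix linear in λ, e(λ) = 8 − rank B(λ), C(λ) = coker B(λ) has dimension
q − rank B(λ) = e(λ) (q = c: as many residual equations as residual unknowns), and Maclean's quadratic obstruction Ob(λ) is a form on ker B(λ)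
with values in C(λ).  E(X) = the finite set of λ ∈ ℙ¹ at which rank B(λ), rank Ob(λ), or (NEW) the coprimality of the tangent-cone quadrics
drops below its generic behaviour.  (†) If at ONE smooth X of the cell and one λ the slice germ (V_λ ∩ S, X) is Artinian of length ℓ then
μ₀(6,3,m;λ) ≤ ℓ (length ≥ multiplicity; upper semicontinuity along N).  rank Ob(λ) = e(e+1)/2 gives the germ K[[v]]/m², length exactly 1 + e
(cell (6,3,0): e = 1, length 2).  NEW (cell (6,3,1): e = 2, dim C = 2, rank Ob = 2 < 3): the slice germ is K[[v₁,v₂]]/(h₁,h₂) with leading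
quadratic forms Q₁, Q₂; LEMMA (L) of the record: if Res(Q₁,Q₂) ≠ 0 then (h₁,h₂) = (Q₁,Q₂), the germ is ≅ K[a,b]/(a²,b²), Hilbert function (1,2,1),
LENGTH 4 (Sylvester: m³ ⊂ m·(Q₁,Q₂) — the polynomial identities `res2_mul_cubic_mem`, `bq_common_zero_trivial` of §2b — then Nakayama).
The resultant is computed for all λ at once as g₃(λ) ∈ ℚ[λ] from MINIMAL polynomial bases of the right kernel (degrees 1,1) and of the left kernel
(degrees 0,0) of B(λ), which specialise to bases at every λ with rank B(λ) = r (irreducibility checked by both programs); g₃ is canonical up to a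
non-zero constant (a change of minimal bases is constant unimodular on each side), so the monic g₃ is an invariant of (X, P, P′) — A = B verbatim.

THE POINTS X (§1).  (6,3,1): `cubicL631a`, 10 monomials, coefficients 1, a Delsarte 4-loop on the plane coordinates plus two couples and two coupling
monomials — its smoothness over ℂ is CERTIFIED BY THE TWO PROGRAMS (record §3) and kernel-checked here only on the strata x₆ = 0, x₇ = 0
(`cubicL631a_critical_in_torus`).  (6,3,0): `cubicC630`, the C-pattern of the (8,3,m) file with one couple — smooth over ℂ, PROVED HERE
(`cubicC630_gradient_only_zero`, `cubicC630_critical_point_origin`).  The (6,3,1) C-pattern point C631 is degenerate for this purpose (g₃ ≡ 0; record §7).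

RESULTS (engine normalisation of λ = the geometric pencil [P] + λ[P′]: s₁ = +1 by the socle pairing in both programs, §4):
* (6,3,1) at X = L631a: q = 8, c = 8, #U = 8, generic rank B = 6, e = 2, dim C = 2, rank Ob = ρ = 2/3; minimal right/left kernel degrees (1, 1) / (0, 0);
  g₁ = λ² (A) / λ² (B), g₂ = λ⁴(λ+1)² (A) / λ¹²(λ+1)² (B), g₃ = λ⁴(λ+1)⁴ (A and B, identical monic polynomial; B's Cramer-structure variant λ²⁸(λ+1)⁴):
  ALL complex zero sets are {0, −1} (§2) ⇒ E(L631a) = {-1, 0, ∞}; at every complex λ ∉ E the slice fibre has LENGTH 4, tangent cone = two coprime quadrics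
  (pass 2 at 7 sample λ: `common root False`; at λ = -1: rank B = 6 but rank Ob = 0/3 — the row's distinguished value, nothing claimed there);
  STRUCTURE: (Q₁,Q₂) = λ(λ+1)·M₀·(v₁², v₁v₂, v₂²)ᵀ with M₀ constant, zero middle column, invertible outer columns (`M0A631_shape`, `squares_of_quadrics`):
  the fibre is K[v₁,v₂]/(v₁²,v₂²) on the nose.  Hence μ₀(6,3,1;λ) ≤ 4 for every complex λ ∉ {0,−1}, = 4 and e_gen = 2 with the lower bound (§5) —
  MU0-TABLE row (6,3,1) (value 4, HF (1,2,1), fibre k̄[a,b]/(a²,b²), valid on ℂ∖{0,−1}) re-derived at a point X ≠ X_F by a method that sees the fibre.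
* (6,3,0) at X = C630: q = 8, c = 8, #U = 8, generic rank B = 7, e = 1, dim C = 1, rank Ob = 1/1 ⇒ LENGTH 2 at every complex λ ∉ E(C630) = {0, 1, ∞}
  (g₁ = λ³ (A, B), g₂ = λ⁴(λ−1) (A) / λ¹⁰(λ−1) (B), zero sets {0, 1}, §2); at λ = 1: rank B = 7, rank Ob = 0/1 (the EXPLAINED-SMOOTH value [P]+[P̌] of the
  census, Kloosterman 2025 Cor. 6.5 — second-order special only).  Hence μ₀(6,3,0;λ) = 2 for every complex λ ∉ {0, 1} with the lower bound e ≥ 1 of §0.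

TWO IMPLEMENTATIONS, VERBATIM-EQUAL CANONICAL OUTPUT (§3, `canonA631_eq_canonB631`, `canonA630_eq_canonB630` by `decide`; 22/22 and 20/20 keys).
A = `gen24/engine/exsetQg.py` (exact rationals, incremental sparse echelon with history vectors; NEW: left minimal basis by block-Toeplitz, Plücker
resultant g₃ over ℚ[λ], ρ-column minors).  B = `gen24/engineB/exsetBg.py` (independent code: modular elimination with histories, Dixon lifting +
rational reconstruction + exact verification of every rational object, Cramer kernel vectors by interpolation, pivot-structure minors; NEW: common-root
test by Euclid, left Cramer vectors, Sylvester determinant by evaluation/interpolation over 2 × 2 Cramer structures, its own greedy minimal bases, and a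
verbatim recomputation of A's g₃ from A's certificate: `xcheckB631_all`).  `res2_eq_sylvester_det` (§2b) identifies the two programs' resultants.

FILES (400-line rule): §1 = `HodgeLocusCensusExSet63Smooth`, §2 = `HodgeLocusCensusExSet63Certs`, §§3–4 = `HodgeLocusCensusExSet63Canon` (all in this
namespace, imported here); this file holds the setting, §0 and §5.

KERNEL-CHECKED HERE: §0 the (6,3,0) instance e ≥ 1 of the tree's Kloosterman inequality; §1 smoothness of C630 over ℂ and the strata x₆x₇ = 0 of L631a;
§2 the complex zero sets of all certificate polynomials of both programs, the resultant identities (Sylvester = Plücker, adjugate memberships, no common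
zero, squares from quadrics) and the shape of the recorded M₀; §3 A = B and what the records say; §4 the intersection arithmetic behind ι = 1/4, −1/8 and
the consistency of the recorded orientation rows; §5 the bookkeeping against `Mu0631.genBound` and `ciHilbert`.  NOT FORMALISED (as in the earlier
files): the IVHS identifications (Carlson–Griffiths, Voisin 5.18), Maclean's second-order obstruction, the computation of B(λ), q(λ), the minimal bases
and the socle values from F (the two programs; logs, certificates and md5 in the record), the Nakayama step of lemma (L), the step length ≥
multiplicity (†), and the smoothness of L631a on x₆x₇ ≠ 0.  Nothing in this file is a statement about the Hodge conjecture.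
-/

namespace Summit.HodgeConjecture.HodgeConjecture.HodgeLocus.Census.ExSet63Char0

/-! ## 0. Input recorded by name: the Kloosterman lower bound in cell (6,3,0), quantitative form (cell (6,3,1) is the tree's
`Literature.AlgebraicGeometry.Kloosterman2025.cubicSixfold_twoThreePlanes_line_two_le_excess`, re-exported by `Mu0631.input_excess_two_le`) -/

noncomputable section LowerBound630

open MvPolynomial Module Literature.RingTheory.MvPolynomial
open Literature.AlgebraicGeometry.HodgeTheory Literature.AlgebraicGeometry.Motives.UniversalHypersurface
  Literature.AlgebraicGeometry.Kloosterman2023 Literature.AlgebraicGeometry.Kloosterman2025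

variable {K : Type*} [Field K]

/-- The arithmetic of cell (6,3,0): `h_{I₁+I₂} = ciHilbert(2)` (one residual coordinate, r = m + 1 = 1) takes the values `h(1) = 1`, `h(3) = 0`. -/
theorem ciHilbert_2_at_1_and_3 :
    ciHilbert (List.replicate 1 2) 1 = 1 ∧ ciHilbert (List.replicate 1 2) 3 = 0 := by
  decide

/-- **Census cell (6,3,0), quantitative form**: two 3-planes in a cubic sixfold meeting in a POINT (`d = 3`, `k = 3`, `c = 3`, `r = 1`,
`(α, β) = (3, 1)`): for every F in normal form with finite-dimensional Jacobian ring, every socle functional ℓ and every c₀,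
`dim (I(Π₁) ∩ I(Π₂))₃ + 1 ≤ dim ker` of the graded multiplication form of ℓ₁ + c₀ℓ₂ on S₃ × S₁ — excess tangent dimension e(X; c₀) ≥ 1 = h(1) − h(3)
for EVERY X of the cell (the instance `(d, c, k) = (3, 3, 3)` of the tree's `twoPlanes_finrank_inf_add_ciHilbert_le`, Kloosterman 2025 Theorem 1.3 /
Example 3.16, census table `census_cells_bounds`); the census lower bound μ₀(6,3,0; λ) ≥ 1 + e ≥ 2. -/
theorem cubicSixfold_twoThreePlanes_point_finrank_inf_add_one_le (κ : Fin 3 ⊕ Fin 1 ≃ Fin (3 + 1))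
    (gA h : Fin 3 → MvPolynomial (Fin (2 * 3 + 2)) K) (gC : Fin 1 → MvPolynomial (Fin (2 * 3 + 2)) K)
    (Q : Fin 3 → Fin 3 → MvPolynomial (Fin (2 * 3 + 2)) K) (P : Fin 1 → MvPolynomial (Fin (2 * 3 + 2)) K)
    (hgA : ∀ i, (gA i).IsHomogeneous 1) (hh : ∀ j, (h j).IsHomogeneous 1) (hgC : ∀ m, (gC m).IsHomogeneous 1)
    (hQ : ∀ i j, (Q i j).IsHomogeneous 1) (hP : ∀ m, (P m).IsHomogeneous 2) {N : ℕ} (hN : 0 < N)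
    (hXN : ∀ l, (X l : MvPolynomial (Fin (2 * 3 + 2)) K) ^ N ∈ jacobianIdeal (twoPlanesForm gA h gC Q P))
    {ℓ : MvPolynomial (Fin (2 * 3 + 2)) K →ₗ[K] K} (hℓ : ∀ p, ℓ (homogeneousComponent 8 p) = ℓ p)
    (hJ : annIdeal ℓ = jacobianIdeal (twoPlanesForm gA h gC Q P)) (c₀ : K) :
    finrank K (idealDegree
        ((Ideal.span (Set.range (plane₁Gens κ gA gC)) ⊔ Ideal.span (Set.range (plane₁Cofs κ h Q P))) ⊓
          (Ideal.span (Set.range (plane₂Gens κ h gC)) ⊔ Ideal.span (Set.range (plane₂Cofs κ gA Q P)))) 3) + 1 ≤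
      finrank K (LinearMap.ker (gradedMulForm
        (ciCycleFunctional ℓ (plane₁Gens κ gA gC) (plane₁Cofs κ h Q P) +
          c₀ • ciCycleFunctional ℓ (plane₂Gens κ h gC) (plane₂Cofs κ gA Q P)) 3 1)) := by
  have h0 := twoPlanes_finrank_inf_add_ciHilbert_le (d := 3) (by norm_num) κ gA h gC Q P hgA hh hgC hQ hP hN hXN
    hℓ hJ (α := 3) (β := 1) (by norm_num) c₀
  have h1 : ciHilbert (List.replicate 1 (3 - 1)) 1 = 1 := by decide
  have h2 : ciHilbert (List.replicate 1 (3 - 1)) 3 = 0 := by decide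
  rw [h1, h2] at h0
  omega

end LowerBound630


/-! ## 5. Bookkeeping of the conclusions (the arithmetic only; the inputs are named in the module docstring) -/

/-- (6,3,1), the arithmetic of (†′) of the record: slice-fibre length ℓ(X;λ) = 4 at one smooth X (§§2–3: at L631a for every complex λ ∉ {0, −1}),
multiplicity ≤ length, μ₀ ≤ multiplicity, and the lower bound μ₀ ≥ `Mu0631.genBound 8 8 e` = 1 + C(e+1,2) of Proposition G of the gen-21 anchor
(q = c = 8: the generic fibre is cut by e equations of order ≥ 2 in e variables) with e ≥ 2 for every X and every λ (`Mu0631.input_excess_two_le`, the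
tree's Kloosterman theorem) force μ₀ = 4 and e = 2 (for e ≥ 3 the bound is ≥ 7). -/
theorem mu0_eq_four_of_length_four {μ₀ e mult : ℕ} (hml : mult ≤ 4) (hμm : μ₀ ≤ mult) (hlow : Mu0631.genBound 8 8 e ≤ μ₀) (he : 2 ≤ e) :
    μ₀ = 4 ∧ e = 2 := by
  have h4 := Mu0631.four_le_genBound_of_eq 8 e he
  have he2 : e = 2 := by
    by_contra hne
    have h3 : 3 ≤ e := by omega
    have hdiv : 2 * e ≤ (e + 1) * e / 2 := by
      apply (Nat.le_div_iff_mul_le (by norm_num)).mpr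
      nlinarith
    unfold Mu0631.genBound at hlow
    omega
  subst he2
  have h22 : Mu0631.genBound 8 8 2 = 4 := by decide
  omega

/-- (6,3,0): slice-fibre length 2 at one smooth X at every complex λ ∉ E(X) = {0, 1, ∞}, and e ≥ 1 (§0, every X, every λ) force μ₀ = 2 and e = 1 — the
arithmetic lemma `ExSet83Char0.mu0_eq_two_of_length_two` of the (8,3,1) anchor, instantiated (not restated). -/
theorem mu0_eq_two_cell_630 {μ₀ eGen mult : ℕ} (hml : mult ≤ 2) (hμm : μ₀ ≤ mult) (hlow : 1 + eGen ≤ μ₀) (he : 1 ≤ eGen) :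
    μ₀ = 2 ∧ eGen = 1 :=
  ExSet83Char0.mu0_eq_two_of_length_two hml hμm hlow he

/-- The generic LENGTHS certified here in characteristic 0 (the `length` fields of §3, equal for A and B) against the bookkeeping already in the tree:
4 = `Mu0631.genBound 8 8 2` (Proposition G of the gen-21 anchor: q = c = 8, b = 2) and 2 = `Mu0631.genBound 8 8 1`; and 4 = Σ of the Hilbert function
(1,2,1,0,…) = `ciHilbert (2,2)` of a complete intersection of two quadrics in two variables — the fibre K[a,b]/(a²,b²). -/
theorem canon_lengths_eq_genBound :
    canonA631.length = Mu0631.genBound 8 8 2 ∧ canonA630.length = Mu0631.genBound 8 8 1 ∧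
    (Literature.AlgebraicGeometry.Kloosterman2023.ciHilbert (List.replicate 2 2) 0 = 1 ∧
      Literature.AlgebraicGeometry.Kloosterman2023.ciHilbert (List.replicate 2 2) 1 = 2 ∧
      Literature.AlgebraicGeometry.Kloosterman2023.ciHilbert (List.replicate 2 2) 2 = 1 ∧
      Literature.AlgebraicGeometry.Kloosterman2023.ciHilbert (List.replicate 2 2) 3 = 0) ∧
    canonA631.length = 1 + 2 + 1 := by
  decide

end Summit.HodgeConjecture.HodgeConjecture.HodgeLocus.Census.ExSet63Char0
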